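import Summits.NavierStokesRegularity.NavierStokesRegularity.Theses.AxisymmetricExtremality
import Summits.NavierStokesRegularity.NavierStokesRegularity.Theorems.AxisymmetricExtremalityPFoldToAxisymmetric
import Summits.NavierStokesRegularity.NavierStokesRegularity.Theorems.AxisymmetricExtremalityAxisymmetricKatoGlobalNoSwirlStratum

/-!
# Strategist sketch (census family `s`, gen 26) for crux `AxisymmetricKatoGlobal`
(item stmt-NavierStokesRegularity-15453, route AxisymmetricExtremality).

Kernel-checked companion of `STRATEGY-CENSUS-s20.md` (0 sorry). It records the
"summit-down" part of the census:

* `NoAxisymMinimalBlowup` (W0) — the WEAKEST statement the route's deciding theorem can consume in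
  place of the crux: no Rusin–Šverák minimal blow-up datum is axisymmetric. `w0_of_crux` (crux ⇒ W0)
  and `closes_of_w0` (MinimalDatumPFold → W0 → NavierStokesRegularity, using the PROVED crux
  `PFoldToAxisymmetric`) show W0 is a legitimate strictly-weaker replacement *as far as logic goes*.
* `AxisymMinimalDataSwirlFree` (W1) — "axisymmetric minimal data are swirl-free"; `w0_of_w1` uses the
  landed no-swirl stratum (`hasGlobalKatoSolution_of_isAxisymmetric_hasNoSwirl_viscosity`), and
  `w1_of_w0` is vacuous, so `w0_iff_w1 : W0 ↔ W1` — the swirl-free reformulation carries NO content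
  beyond W0 (this is why the census files no "reduce to the no-swirl sibling" line).

Nothing here is a new route item; the census explains why W0 has no tool of its own
(minimality yields only the norm floor and the swirl dial, no rigidity).
-/

set_option linter.dupNamespace false

namespace Summit.NavierStokesRegularity.NavierStokesRegularity.Cruxes.AxisymmetricKatoGlobal.StrategistS20g26

open Summit.NavierStokesRegularity.NavierStokesRegularity.Theses.AxisymmetricExtremality
open Literature.Analysis.FluidPDE

/-- **W0** — no axisymmetric Rusin–Šverák minimal blow-up datum (threshold instance of the crux;
exactly what `closes` consumes). -/
def NoAxisymMinimalBlowup : Prop :=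
  ∀ ν : ℝ, 0 < ν → ¬ ∃ (u₀ : EuclideanSpace ℝ (Fin 3) → EuclideanSpace ℝ (Fin 3))
    (g : Literature.Analysis.FunctionSpaces.HomSobolev (EuclideanSpace ℝ (Fin 3))
      (EuclideanSpace ℂ (Fin 3)) (1 / 2 : ℝ)),
    IsMinimalBlowupDatum ν u₀ g ∧ IsAxisymmetric u₀

/-- **W1** — every axisymmetric minimal blow-up datum is swirl-free (`Γ = r u_θ ≡ 0`). -/
def AxisymMinimalDataSwirlFree : Prop :=
  ∀ ν : ℝ, 0 < ν → ∀ (u₀ : EuclideanSpace ℝ (Fin 3) → EuclideanSpace ℝ (Fin 3))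
    (g : Literature.Analysis.FunctionSpaces.HomSobolev (EuclideanSpace ℝ (Fin 3))
      (EuclideanSpace ℂ (Fin 3)) (1 / 2 : ℝ)),
    IsMinimalBlowupDatum ν u₀ g → IsAxisymmetric u₀ → HasNoSwirl u₀

/-- crux ⇒ W0 (the crux is consumed by `closes` only through this instance). -/
theorem w0_of_crux (h : AxisymmetricKatoGlobal) : NoAxisymMinimalBlowup := by
  rintro ν hν ⟨u₀, g, hmin, hax⟩
  obtain ⟨hL3, hrep, hdiv, -, hnot⟩ := hmin
  exact hnot (h ν hν u₀ g hL3 hrep hdiv (fun θ x => hax θ x))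

/-- W0 replaces the crux in the deciding theorem: `MinimalDatumPFold → W0 → Clay (A)`, using the
PROVED crux `PFoldToAxisymmetric` (`axisymmetricExtremality_pFoldToAxisymmetric_proof`). Mirrors
`closes` (pure logic, by contradiction on the Clay conclusion). -/
theorem closes_of_w0 (h₂ : MinimalDatumPFold) (h0 : NoAxisymMinimalBlowup) :
    NavierStokesRegularity := by
  show Literature.NS.NavierStokesExistenceSmoothR3
  intro ν hν u₀ hsm hdiv hdec
  by_contra hno
  obtain ⟨u₁, g, hmin, hax⟩ :=
    Summit.NavierStokesRegularity.NavierStokesRegularity.Theorems.axisymmetricExtremality_pFoldToAxisymmetric_proof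
      ν hν (h₂ ν hν ⟨u₀, hsm, hdiv, hdec, hno⟩)
  exact h0 ν hν ⟨u₁, g, hmin, fun θ x => hax θ x⟩

/-- W1 ⇒ W0: a swirl-free axisymmetric minimal datum has a global Kato solution by the landed
no-swirl stratum, contradicting minimality. -/
theorem w0_of_w1 (h1 : AxisymMinimalDataSwirlFree) : NoAxisymMinimalBlowup := by
  rintro ν hν ⟨u₀, g, hmin, hax⟩
  have hsw : HasNoSwirl u₀ := h1 ν hν u₀ g hmin hax
  obtain ⟨hL3, -, hdiv, -, hnot⟩ := hmin
  exact hnot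
    (Summit.NavierStokesRegularity.NavierStokesRegularity.Theorems.AxisymmetricKatoGlobal.NoSwirlStratum.hasGlobalKatoSolution_of_isAxisymmetric_hasNoSwirl_viscosity
      hν hL3 hdiv hax hsw)

/-- W0 ⇒ W1 is vacuous. -/
theorem w1_of_w0 (h0 : NoAxisymMinimalBlowup) : AxisymMinimalDataSwirlFree := by
  intro ν hν u₀ g hmin hax
  exact absurd ⟨u₀, g, hmin, hax⟩ (h0 ν hν)

/-- Over the tree the "swirl-free" reformulation W1 is EQUIVALENT to W0: it adds no content. -/
theorem w0_iff_w1 : NoAxisymMinimalBlowup ↔ AxisymMinimalDataSwirlFree :=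
  ⟨w1_of_w0, w0_of_w1⟩

/-- Hence also `MinimalDatumPFold → W1 → Clay (A)`. -/
theorem closes_of_w1 (h₂ : MinimalDatumPFold) (h1 : AxisymMinimalDataSwirlFree) :
    NavierStokesRegularity :=
  closes_of_w0 h₂ (w0_of_w1 h1)

end Summit.NavierStokesRegularity.NavierStokesRegularity.Cruxes.AxisymmetricKatoGlobal.StrategistS20g26
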